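import Mathlib
import Literature.AlgebraicGeometry.Resolution.NormalizationSection
import HarnessLib

/-!
# A normal model dominating `V` maps to the relative normalisation in `V`
# (crux `WildQuotients.WildQuotientResolution`, stub `stub_phaseZeroHighDim`: brick (E1) of the reshaping R3*)

Crux stmt-ResolutionOfSingularities-15640 (`WildQuotientResolution`), registered stub `stub_phaseZeroHighDim`.
After ✓`FromNormalizationFinite.phaseZero_conclusion_of_equivariantRegularModels'` the stub is (H1) Abbes–Saito
2.22 + (H3) «equivariant regular models of the equivariant models of `X′`»; (H3) is used once, for the relative
normalisation `Xs` of the admissible blow-up `Q′` in the dense open `V ⊆ X′`. To replace (H3) by equivariant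
PRINCIPALISATION on the regular `X′` (memo PHASE0-H2-DISCHARGED.md, R3*) one needs that a NORMAL model `Z ⊇ V`
over `Q′` maps to `Xs`. This file proves the underlying plumbing lemma, from Mathlib's universal property of
relative normalisation (`Scheme.Hom.normalizationDesc`) and the tree's ✓`isIso_fromNormalization_of_section`:

* `exists_hom_normalization_comp` — if `j : V → Z` has `j.fromNormalization` an isomorphism (i.e. `Z` is its
  own normalisation in `V`) then for every qcqs `h : Z → Q` there is `β : Z → (j ≫ h).normalization` with
  `j ≫ β = (j ≫ h).toNormalization` and `β ≫ (j ≫ h).fromNormalization = h`;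
* `isIso_fromNormalization_of_isOpenImmersion` — a dense quasi-compact open immersion `j : V → Z` into an
  integral NORMAL scheme has `j.fromNormalization` an isomorphism;
* `exists_hom_normalization_of_normal` — the combination.

[OURS · crux stmt-ResolutionOfSingularities-15640 · helper toward `stub_phaseZeroHighDim` (brick (E1) of the
recommended reshaping R3* of the open residual (H3)); counted 0; AI-level work, weaker than expert review.]
-/

-- single-problem summit: the doubled namespace component `ResolutionOfSingularities` is forced
set_option linter.dupNamespace false

noncomputable section

open CategoryTheory CategoryTheory.Limits AlgebraicGeometry TopologicalSpace
open Literature.AlgebraicGeometry.Resolution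

namespace Summit.ResolutionOfSingularities.ResolutionOfSingularities.Theorems.WildQuotientResolution.NormalToNormalization

universe u

/-- **A scheme which is its own normalisation in `V` maps to every relative normalisation in `V` below it.**
If `j : V → Z` is qcqs with `j.fromNormalization : Z^ν(j) → Z` an isomorphism, then for every qcqs
`h : Z → Q` there is `β : Z → Q^ν(j ≫ h)` under `V` and over `Q`. Construction: the base change
`T = Q^ν(j ≫ h) ×_Q Z → Z` is integral, so `V → T` factors through `Z^ν(j) ≅ Z`
(Mathlib `Scheme.Hom.normalizationDesc`). [cite: StacksProject, Tag 035I] -/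
theorem exists_hom_normalization_comp {V Z Q : Scheme.{u}} (j : V ⟶ Z) (h : Z ⟶ Q)
    [QuasiCompact j] [QuasiSeparated j] [QuasiCompact h] [QuasiSeparated h]
    [IsIso j.fromNormalization] :
    ∃ β : Z ⟶ (j ≫ h).normalization,
      j ≫ β = (j ≫ h).toNormalization ∧ β ≫ (j ≫ h).fromNormalization = h := by
  let f₁ : V ⟶ pullback (j ≫ h).fromNormalization h :=
    pullback.lift (j ≫ h).toNormalization j (by rw [Scheme.Hom.toNormalization_fromNormalization])
  have H : j = f₁ ≫ pullback.snd (j ≫ h).fromNormalization h := (pullback.lift_snd _ _ _).symm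
  have e1 : j ≫ inv j.fromNormalization = j.toNormalization := by
    rw [← cancel_mono j.fromNormalization, Category.assoc, IsIso.inv_hom_id, Category.comp_id,
      Scheme.Hom.toNormalization_fromNormalization]
  refine ⟨inv j.fromNormalization ≫ j.normalizationDesc f₁ _ H ≫ pullback.fst _ _, ?_, ?_⟩
  · rw [← Category.assoc, e1, ← Category.assoc, Scheme.Hom.toNormalization_normalizationDesc]
    exact pullback.lift_fst _ _ _
  · rw [Category.assoc, Category.assoc, pullback.condition,
      Scheme.Hom.normalizationDesc_comp_assoc, IsIso.inv_hom_id_assoc]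

/-- **A quasi-compact open immersion `j : V → Z` of a non-empty `V` into an integral NORMAL scheme has
`j.fromNormalization` an isomorphism**: `Z` is its own normalisation in the dense open `V` (a local section of
`j` over a non-empty affine open inside the image; ✓`isIso_fromNormalization_of_section`). [folklore] -/
theorem isIso_fromNormalization_of_isOpenImmersion {V Z : Scheme.{u}} (j : V ⟶ Z) [IsOpenImmersion j]
    [QuasiCompact j] [IsIntegral V] [IsIntegral Z]
    (hZ : ∀ z : Z, IsIntegrallyClosed (Z.presheaf.stalk z)) : IsIso j.fromNormalization := by
  -- a non-empty affine open `U ⊆ j(V)` and the section `σ : U → V` of `j` over it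
  obtain ⟨v⟩ := (inferInstance : Nonempty V)
  obtain ⟨_, ⟨U, hU, rfl⟩, hvU, hUle⟩ := Z.isBasis_affineOpens.exists_subset_of_mem_open
    (Set.mem_range_self v : j.base v ∈ Set.range j.base) j.isOpenEmbedding.isOpen_range
  let U' : Z.Opens := U
  haveI : Nonempty U' := ⟨⟨j.base v, hvU⟩⟩
  have hsub : Set.range U'.ι.base ⊆ Set.range j.base := by
    rw [Scheme.Opens.range_ι]; exact hUle
  exact isIso_fromNormalization_of_section j hZ hU (IsOpenImmersion.lift j U'.ι hsub)
    (IsOpenImmersion.lift_fac j U'.ι hsub)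

/-- **A normal integral scheme `Z` containing `V` as a dense (quasi-compact) open maps to the relative
normalisation of any `Q` below it in `V`**: for `j : V → Z` a quasi-compact open immersion, `V` non-empty,
`Z` integral with integrally closed stalks and `h : Z → Q` qcqs, there is `β : Z → Q^ν(j ≫ h)` with
`j ≫ β = (j ≫ h).toNormalization` and `β ≫ (j ≫ h).fromNormalization = h`. [cite: StacksProject, Tag 035I] -/
theorem exists_hom_normalization_of_normal {V Z Q : Scheme.{u}} (j : V ⟶ Z) [IsOpenImmersion j]
    [QuasiCompact j] [IsIntegral V] [IsIntegral Z] (hZ : ∀ z : Z, IsIntegrallyClosed (Z.presheaf.stalk z))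
    (h : Z ⟶ Q) [QuasiCompact h] [QuasiSeparated h] :
    ∃ β : Z ⟶ (j ≫ h).normalization,
      j ≫ β = (j ≫ h).toNormalization ∧ β ≫ (j ≫ h).fromNormalization = h := by
  haveI := isIso_fromNormalization_of_isOpenImmersion j hZ
  exact exists_hom_normalization_comp j h

end Summit.ResolutionOfSingularities.ResolutionOfSingularities.Theorems.WildQuotientResolution.NormalToNormalization

end
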